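import Summits.FinalStateConjecture.FinalStateConjecture.Theorems.ClusterCompletenessRecurrentlyFlatDispersesStubSlabCauchy
import Summits.FinalStateConjecture.FinalStateConjecture.Theorems.ClusterCompletenessRecurrentlyFlatDispersesChartTimeExhaustive
import Summits.FinalStateConjecture.FinalStateConjecture.Theorems.ClusterCompletenessRecurrentlyFlatDispersesCausalFuture
import Literature.Geometry.Manifold.InverseFunctionTheorem

/-!
# Crux `RecurrentlyFlatDisperses` (stmt-FinalStateConjecture-14665), line `Sketch` — every late slab of
# the anchored chart is met EXACTLY ONCE by every endless causal curve through the chart region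

Continuation lead c3, 2026-08-16. The capstone of the causal geometry of the crux's anchored flat late
chart `Ψ₀` (late image `W = Ψ₀{x⁰ > τ₀}`): for every `τ > τ₀`, every future causal curve of the
development which is endless in both directions and meets `W` meets the late slab `S_τ = Ψ₀{x⁰ = τ}`
at exactly one parameter — `S_τ` is a Cauchy hypersurface for the causal curves through `W` (the
kernel form of "a restart from a late slab loses no part of the chart region", card
`outgoing-blind-cup-restart`, point (4)). Assembly of landed bricks only:

* EXISTENCE: from the meeting point, chart time is exhausted to the future
  (`exists_mem_image_lateRegion`, p125651: the curve reaches `Ψ₀{x⁰ > τ}`), and from there the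
  past-endless curve meets `S_τ` (`stub_slabCauchy`, p120304);
* UNIQUENESS: between two parameters on `S_τ` the curve stays in `W` (`J⁺(W) ⊆ W`,
  `causalFuture_image_lateRegion_subset`, p125793) and the chart time of its lift increases strictly
  (`ChartSlab.chartTime_lt_of_curve`, from the landed causal cone estimate and lift
  `SlabCauchy.lift_cone_causal`, `FutureSet.strictMonoOn_apply_zero`), while both ends have chart time `τ`.

Mathlib + the Literature cone + landed bricks; no definitions, no named facts.
-/

noncomputable section

open scoped Manifold ContDiff Topology
open Bundle Filter Set Function TopologicalSpace Literature.Geometry.Lorentzian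

namespace Summit.FinalStateConjecture.FinalStateConjecture.Theorems.RecurrentlyFlatDisperses

namespace ChartSlab

/-- **Chart time increases strictly along causal curves in the anchored chart region (geometric
form).** For `Ψ₀ : U₀ → 𝓢` smooth on an open `U₀ ⊇ {x⁰ > τ₀}`, an open embedding on the late region,
anchored with `dΨ₀ ∂₀` future-directed there: if a future causal curve `γ` on `[a, b]`, `a < b`, runs
inside the late image, then the chart time of `γ b` exceeds that of `γ a`. -/
theorem chartTime_lt_of_curve {𝓢 : Spacetime 4} {U₀ : Opens E4} {Ψ₀ : U₀ → 𝓢.carrier} {τ₀ : ℝ}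
    (hΨs : ContMDiff 𝓘(ℝ, E4) (𝓡 4) ∞ Ψ₀)
    (hemb : Topology.IsOpenEmbedding (((Minkowski.backgroundOn U₀).lateRegion τ₀).restrict Ψ₀))
    (hU : {x : E4 | τ₀ < x 0} ⊆ (U₀ : Set E4))
    (hdev : ∀ y : U₀, τ₀ < y.1 0 → ‖𝓢.deviation (Minkowski.backgroundOn U₀) Ψ₀ y‖ ≤ 1 / 4)
    (hfut : ∀ y : U₀, τ₀ < y.1 0 →
      𝓢.timeOrientation.IsFutureDirected (mfderiv 𝓘(ℝ, E4) (𝓡 4) Ψ₀ y (E4.basisVector 0)))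
    {γ : ℝ → 𝓢.carrier} {a b : ℝ} (hab : a < b)
    (hγ : 𝓢.metric.IsFutureCausalCurveOn 𝓢.timeOrientation γ (Icc a b))
    (hW : ∀ v ∈ Icc a b, γ v ∈ Ψ₀ '' (Minkowski.backgroundOn U₀).lateRegion τ₀)
    {ya yb : U₀} (ha : γ a = Ψ₀ ya) (hb : γ b = Ψ₀ yb) (hya : τ₀ < ya.1 0) (hyb : τ₀ < yb.1 0) :
    ya.1 0 < yb.1 0 := by
  -- the late half-space `V` and the chart `Φ = Ψ₀|V` (as in the landed `stub_slabCauchy`)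
  obtain ⟨V, hVmem⟩ : ∃ V : Opens E4, ∀ p : E4, p ∈ V ↔ τ₀ < p 0 :=
    ⟨⟨{x : E4 | τ₀ < x 0}, isOpen_lt continuous_const (PiLp.continuous_apply 2 _ 0)⟩,
      fun _ ↦ Iff.rfl⟩
  have hVU : V ≤ U₀ := fun p hp ↦ hU ((hVmem p).1 hp)
  haveI : Nonempty V :=
    ⟨⟨(τ₀ + 1) • (E4.basisVector 0 : E4), (hVmem _).2 (by simp [E4.basisVector])⟩⟩
  have hlate : ∀ x : V, τ₀ < (Opens.inclusion hVU x).1 0 := fun x ↦ (hVmem x.1).1 x.2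
  set Φ : V → 𝓢.carrier := Ψ₀ ∘ Opens.inclusion hVU with hΦdef
  have hΦs : ContMDiff 𝓘(ℝ, E4) (𝓡 4) ∞ Φ := hΨs.comp (contMDiff_inclusion hVU)
  have hdΦ : ∀ x : V, mfderiv 𝓘(ℝ, E4) (𝓡 4) Φ x =
      mfderiv 𝓘(ℝ, E4) (𝓡 4) Ψ₀ (Opens.inclusion hVU x) := fun x ↦
    FutureSet.mfderiv_comp_inclusion hVU x (hΨs.mdifferentiableAt (by simp))
  have hrange : range Φ = Ψ₀ '' (Minkowski.backgroundOn U₀).lateRegion τ₀ :=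
    FutureSet.range_comp_inclusion hVU Ψ₀ hVmem
  have hinj : Injective Φ := by
    intro x₁ x₂ h
    have h' : (⟨Opens.inclusion hVU x₁, hlate x₁⟩ :
        (Minkowski.backgroundOn U₀).lateRegion τ₀) = ⟨Opens.inclusion hVU x₂, hlate x₂⟩ :=
      hemb.injective h
    exact Subtype.ext (congrArg (fun y : (Minkowski.backgroundOn U₀).lateRegion τ₀ ↦
      (y.1 : E4)) h')
  have hloc : IsLocalDiffeomorph 𝓘(ℝ, E4) (𝓡 4) ∞ Φ := fun x ↦ by
    have hinjd : Injective (mfderiv 𝓘(ℝ, E4) (𝓡 4) Φ x) := by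
      rw [hdΦ x]
      exact FutureSet.mfderiv_injective_of_deviation Ψ₀ _ (hdev _ (hlate x))
    set A : E4 →L[ℝ] E4 := mfderiv 𝓘(ℝ, E4) (𝓡 4) Φ x with hA
    have hinjA : Injective (A : E4 →ₗ[ℝ] E4) := hinjd
    have hbij : Bijective (A : E4 →ₗ[ℝ] E4) :=
      ⟨hinjA, LinearMap.injective_iff_surjective.1 hinjA⟩
    set e : E4 ≃L[ℝ] E4 := (LinearEquiv.ofBijective (A : E4 →ₗ[ℝ] E4) hbij).toContinuousLinearEquiv
      with he
    exact Literature.Geometry.Manifold.isLocalDiffeomorphAt_of_mfderiv (by simp) isOpen_univ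
      (mem_univ x) hΦs.contMDiffOn e (by ext v; rfl)
  have hcone : ∀ (x : V) (w : E4),
      𝓢.timeOrientation.IsFutureDirected (mfderiv 𝓘(ℝ, E4) (𝓡 4) Φ x w) →
      0 < w 0 ∧ ‖w‖ < 2 * w 0 := by
    intro x w hf
    rw [hdΦ x] at hf
    exact SlabCauchy.cone_of_deviation_causal Ψ₀ (Opens.inclusion hVU x) (hdev _ (hlate x))
      (hfut _ (hlate x)) w hf
  -- the endpoints read through `Φ`
  set xa : V := ⟨(ya : E4), (hVmem _).2 hya⟩ with hxa
  set xb : V := ⟨(yb : E4), (hVmem _).2 hyb⟩ with hxb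
  have hΦa : Φ xa = Ψ₀ ya := congrArg Ψ₀ (Subtype.ext rfl)
  have hΦb : Φ xb = Ψ₀ yb := congrArg Ψ₀ (Subtype.ext rfl)
  have hW' : ∀ v ∈ Icc a b, γ v ∈ range Φ := fun v hv ↦ hrange ▸ hW v hv
  -- chart time increases strictly along the lift
  set c : ℝ → E4 := fun u ↦ ((Function.invFun Φ (γ u) : V) : E4) with hc
  have hder : ∀ v ∈ Icc a b, HasDerivAt c (deriv c v) v ∧ 0 < deriv c v 0 := fun v hv ↦ by
    obtain ⟨hd, h1, -⟩ := SlabCauchy.lift_cone_causal hΦs hinj hloc hcone (hγ v hv).1 (hγ v hv).2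
      (hW' v hv)
    exact ⟨hd, h1⟩
  have hmono : StrictMonoOn (fun v ↦ c v 0) (Icc a b) :=
    FutureSet.strictMonoOn_apply_zero (w := fun v ↦ deriv c v) (convex_Icc a b) hder
  have hlt : c a 0 < c b 0 := hmono ⟨le_rfl, hab.le⟩ ⟨hab.le, le_rfl⟩ hab
  have hca : Function.invFun Φ (γ a) = xa := by
    rw [ha, ← hΦa]
    exact Function.leftInverse_invFun hinj xa
  have hcb : Function.invFun Φ (γ b) = xb := by
    rw [hb, ← hΦb]
    exact Function.leftInverse_invFun hinj xb
  have h1 : c a 0 = (ya : E4) 0 := by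
    show ((Function.invFun Φ (γ a) : V) : E4) 0 = (ya : E4) 0
    rw [hca]
  have h2 : c b 0 = (yb : E4) 0 := by
    show ((Function.invFun Φ (γ b) : V) : E4) 0 = (yb : E4) 0
    rw [hcb]
  rw [h1, h2] at hlt
  exact hlt

end ChartSlab

/-! ### The crux-vocabulary form -/

/-- **Late slabs are Cauchy for the causal curves through the crux's anchored chart region.** In a
maximal vacuum Cauchy development of admissible data, for an anchored flat late chart of the crux's
shape (hypotheses = the five anchored-chart conjuncts of `Theses.ClusterCompleteness.RecurrentlyFlatDisperses`,
verbatim) and every `τ > τ₀`: a future causal curve on an order-connected parameter set which is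
endless in both directions and meets the late image `Ψ₀ '' lateRegion τ₀` meets the slab
`Ψ₀ '' timeSlab τ` at EXACTLY ONE parameter. -/
theorem existsUnique_mem_image_timeSlab :
    ∀ (X : Type) [TopologicalSpace X] [ChartedSpace E3 X] [IsManifold (𝓡 3) ∞ X] [T2Space X]
      [SecondCountableTopology X] [ConnectedSpace X],
      ∀ D ∈ admissibleVacuumData X, ∀ 𝒟 : VacuumCauchyDevelopment D, 𝒟.IsMaximal →
        ∀ (O : Set 𝒟.carrier) (τ₀ : ℝ) (U₀ : Opens E4) (Ψ₀ : U₀ → 𝒟.carrier),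
          (𝒟.toSpacetime.IsLateChart (Minkowski.backgroundOn U₀) O τ₀ Ψ₀ ∧
            {x : E4 | τ₀ < x 0} ⊆ (U₀ : Set E4) ∧
            O = Summit.FinalStateConjecture.exteriorOf 𝒟.toCauchyDevelopment
              (Ψ₀ '' (Minkowski.backgroundOn U₀).lateRegion τ₀) ∧
            (∀ τ₁ : ℝ, τ₀ < τ₁ → O \ Ψ₀ '' (Minkowski.backgroundOn U₀).lateRegion τ₁ ⊆
              𝒟.metric.causalPast 𝒟.timeOrientation
                (Ψ₀ '' (Minkowski.backgroundOn U₀).timeSlab τ₁)) ∧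
            (∀ τ : ℝ, τ₀ < τ → 𝒟.toSpacetime.deviationCk (Minkowski.backgroundOn U₀) Ψ₀ 0 τ ≤
              ENNReal.ofReal (1 / 4))) →
          ∀ τ : ℝ, τ₀ < τ → ∀ (γ : ℝ → 𝒟.carrier) (s : Set ℝ), s.OrdConnected →
            𝒟.metric.IsFutureCausalCurveOn 𝒟.timeOrientation γ s →
            IsFutureEndless γ s → IsPastEndless γ s →
            (∃ t ∈ s, γ t ∈ Ψ₀ '' (Minkowski.backgroundOn U₀).lateRegion τ₀) →
              ∃! t', t' ∈ s ∧ γ t' ∈ Ψ₀ '' (Minkowski.backgroundOn U₀).timeSlab τ := by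
  intro X _ _ _ _ _ _ D hD 𝒟 hmax O τ₀ U₀ Ψ₀ hyp τ hτ γ s hs hγ hfend hpend hmeet
  have hA := stub_anchorCone
  have hT := stub_chartFuture hA
  have hF := stub_futureSet hA hT
  have hdev : ∀ y : U₀, τ₀ < y.1 0 →
      ‖𝒟.toSpacetime.deviation (Minkowski.backgroundOn U₀) Ψ₀ y‖ ≤ 1 / 4 :=
    hA X D hD 𝒟 hmax O τ₀ U₀ Ψ₀ hyp
  have hfut : ∀ y : U₀, τ₀ < y.1 0 →
      𝒟.timeOrientation.IsFutureDirected (mfderiv 𝓘(ℝ, E4) (𝓡 4) Ψ₀ y (E4.basisVector 0)) :=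
    hT X D hD 𝒟 hmax O τ₀ U₀ Ψ₀ hyp
  have hJ := causalFuture_image_lateRegion_subset X D hD 𝒟 hmax O τ₀ U₀ Ψ₀ hyp
  have hexh := exists_mem_image_lateRegion X D hD 𝒟 hmax O τ₀ U₀ Ψ₀ hyp γ s hs hγ hfend
  have hslab := stub_slabCauchy hA hT hF X D hD 𝒟 hmax O τ₀ U₀ Ψ₀ hyp τ hτ γ s hs hγ hpend
  obtain ⟨hchart, hU, -, -, -⟩ := hyp
  obtain ⟨t, ht, hγt⟩ := hmeet
  -- existence: reach the chart above `τ`, then meet the slab below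
  obtain ⟨t₁, ht₁, -, hγt₁⟩ := hexh t ht hγt τ
  obtain ⟨t', ht', -, hγt'⟩ := hslab t₁ ht₁ hγt₁
  refine ⟨t', ⟨ht', hγt'⟩, ?_⟩
  -- uniqueness: chart time increases strictly along the curve inside `W`
  rintro t'' ⟨ht'', hγt''⟩
  have hslabW : Ψ₀ '' (Minkowski.backgroundOn U₀).timeSlab τ ⊆
      Ψ₀ '' (Minkowski.backgroundOn U₀).lateRegion τ₀ :=
    image_mono ((Minkowski.backgroundOn U₀).timeSlab_subset_lateRegion hτ)
  -- a causal segment of `γ` starting on the slab stays in `W`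
  have hstay : ∀ {u v : ℝ}, u ∈ s → v ∈ s → u ≤ v →
      γ u ∈ Ψ₀ '' (Minkowski.backgroundOn U₀).timeSlab τ →
      ∀ w ∈ Icc u v, γ w ∈ Ψ₀ '' (Minkowski.backgroundOn U₀).lateRegion τ₀ := by
    intro u v hu hv huv hγu w hw
    have hγuW := hslabW hγu
    have h1 : γ w ∈ 𝒟.metric.causalFuture 𝒟.timeOrientation {γ u} :=
      IsFutureCausalCurveOn.apply_mem_causalFuture 𝒟.timeOrientation hw.1
        (hγ.mono fun z hz ↦ hs.out hu hv ⟨hz.1, hz.2.trans hw.2⟩)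
    refine hJ ?_
    rcases h1 with h1 | ⟨_, hx, γ', a', b', hab', hγ', hγ'a, hγ'b⟩
    · rw [mem_singleton_iff] at h1
      rw [h1]
      exact Or.inl hγuW
    · rw [mem_singleton_iff] at hx
      exact Or.inr ⟨γ u, hγuW, γ', a', b', hab', hγ', hγ'a.trans hx, hγ'b⟩
  -- compare the two parameters
  by_contra hne
  rcases lt_or_gt_of_ne hne with hlt | hlt
  · -- `t'' < t'`
    obtain ⟨ya, hya, hyaeq⟩ := hγt''
    obtain ⟨yb, hyb, hybeq⟩ := hγt'
    have hya' : (ya : E4) 0 = τ := hya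
    have hyb' : (yb : E4) 0 = τ := hyb
    have key := ChartSlab.chartTime_lt_of_curve (𝓢 := 𝒟.toSpacetime) hchart.contMDiff
      hchart.isOpenEmbedding hU hdev hfut hlt (hγ.mono fun z hz ↦ hs.out ht'' ht' hz)
      (hstay ht'' ht' hlt.le ⟨ya, hya, hyaeq⟩) hyaeq.symm hybeq.symm
      (by rw [hya']; exact hτ) (by rw [hyb']; exact hτ)
    rw [hya', hyb'] at key
    exact lt_irrefl _ key
  · -- `t' < t''`
    obtain ⟨ya, hya, hyaeq⟩ := hγt'
    obtain ⟨yb, hyb, hybeq⟩ := hγt''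
    have hya' : (ya : E4) 0 = τ := hya
    have hyb' : (yb : E4) 0 = τ := hyb
    have key := ChartSlab.chartTime_lt_of_curve (𝓢 := 𝒟.toSpacetime) hchart.contMDiff
      hchart.isOpenEmbedding hU hdev hfut hlt (hγ.mono fun z hz ↦ hs.out ht' ht'' hz)
      (hstay ht' ht'' hlt.le ⟨ya, hya, hyaeq⟩) hyaeq.symm hybeq.symm
      (by rw [hya']; exact hτ) (by rw [hyb']; exact hτ)
    rw [hya', hyb'] at key
    exact lt_irrefl _ key

end Summit.FinalStateConjecture.FinalStateConjecture.Theorems.RecurrentlyFlatDisperses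

end
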